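import Mathlib
import Literature.AlgebraicGeometry.Resolution.CobordantGame

/-!
# `WeightedInvariant.LocalWeightedDrop`: the GRADED SLICE objects of the graded game (slice lattice, slice germ) and
# the rank-`0` / monotonicity bookkeeping of `GradedWonBy`

Route `ResolutionOfSingularities/WeightedInvariant`, crux `LocalWeightedDrop` (stmt-ResolutionOfSingularities-8899).
[OURS · L1 W4.3] — the two slice DEFINITIONS of §5 R3-T3 of ideator res-L1-w43-idea-1's `Sketch-L1-idea-1.lean` v3
(sha16 `631198685223c190`, round 3), landed VERBATIM next to the graded-game module `…Theorems.GradedGame`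
(`WeightedInvariantLocalWeightedDropGradedGame`, p498029) so that the slice statement R3-T3 `gradedWonBy_slice_iff` — the
line's conjectural «induction vehicle» (the graded game at an exceptional point is computed on the `n`-variable slice) — can be
stated, probed and, in whatever form survives, registered.  R3-T3 itself is NOT stated here (it is conjectural; see the companion
probe file `WeightedInvariantLocalWeightedDropGradedSliceRank`).  Nothing here is a statement of the manuscript under review on
ladder RESOLUTION; no new mathematics beyond the sketch.

* `GradedGame.sliceLattice L i₀` — restrict characters of `k[[s, y₁..yₙ]]` to the coordinates `≠ i₀.succ` (re-indexed by
  `Fin.succAbove`): the character lattice of the same diagonalizable group acting on the slice `{y_{i₀} = 0}`.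
* `GradedGame.sliceGerm i₀ g` — the slice restriction `h = g|_{y_{i₀} = 0}` as an `n`-variable germ.
* `GradedGame.coeff_sliceGerm`, `GradedGame.mem_sliceLattice_iff` — unfolding lemmas.

Route-independent (imports `Mathlib` and `CobordantGame` only), so that a future slice-stub registration can import it without
the Theses cone.
-/

set_option linter.dupNamespace false -- mandated namespace of this single-conjunct summit
set_option autoImplicit false

namespace Summit.ResolutionOfSingularities.ResolutionOfSingularities.Theorems

namespace GradedGame

open MvPowerSeries
open Literature.AlgebraicGeometry.Resolution

variable {k : Type} [Field k]

/-- The slice lattice: restrict characters to the coordinates `≠ i₀.succ` of `k[[s, y₁..yₙ]]` (re-indexed by `Fin.succAbove`);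
for `L = succLattice … c` with `c_{i₀} ≠ 0 < w_{i₀}` the frozen coordinate has trivial character (`e_{i₀.succ} ∈ L`), so this image
is the character lattice of the same group acting on the slice. [OURS · L1 W4.3, Sketch-L1-idea-1 v3 §5 — verbatim] -/
def sliceLattice {n : ℕ} (L : AddSubgroup (Fin (n + 1) → ℤ)) (i₀ : Fin n) : AddSubgroup (Fin n → ℤ) :=
  L.map (LinearMap.funLeft ℤ ℤ (i₀.succ.succAbove)).toAddMonoidHom

/-- The slice restriction `h = g|_{y_{i₀} = 0}` as an `n`-variable germ (variables `s, y_{≠i₀}` re-indexed by `succAbove`).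
[OURS · L1 W4.3, Sketch-L1-idea-1 v3 §5 — verbatim] -/
noncomputable def sliceGerm {n : ℕ} (i₀ : Fin n) (g : MvPowerSeries (Fin (n + 1)) k) : MvPowerSeries (Fin n) k :=
  fun e => coeff (e.embDomain ⟨i₀.succ.succAbove, Fin.succAbove_right_injective⟩) g

/-- Coefficients of the slice germ: the coefficient of `e` is the coefficient of `g` at the exponent `e` transported along
`succAbove` (exponent `0` in the frozen variable). [OURS · L1 W4.3] -/
theorem coeff_sliceGerm {n : ℕ} (i₀ : Fin n) (g : MvPowerSeries (Fin (n + 1)) k) (e : Fin n →₀ ℕ) :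
    coeff e (sliceGerm i₀ g) = coeff (e.embDomain ⟨i₀.succ.succAbove, Fin.succAbove_right_injective⟩) g :=
  rfl

/-- Membership in the slice lattice: `u ∈ sliceLattice L i₀` iff `u` is the restriction along `succAbove` of some `v ∈ L`.
[OURS · L1 W4.3] -/
theorem mem_sliceLattice_iff {n : ℕ} (L : AddSubgroup (Fin (n + 1) → ℤ)) (i₀ : Fin n) (u : Fin n → ℤ) :
    u ∈ sliceLattice L i₀ ↔ ∃ v ∈ L, (fun j => v (i₀.succ.succAbove j)) = u := by
  simp only [sliceLattice, AddSubgroup.mem_map, LinearMap.toAddMonoidHom_coe]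
  rfl

end GradedGame

end Summit.ResolutionOfSingularities.ResolutionOfSingularities.Theorems
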